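import Mathlib.Analysis.SpecialFunctions.Integrals.Basic
import Summits.QuantumFields.BalabanUV.Beta.EriceFlowEnclosureSmoothClauseCalc

/-!
# Beta / EriceFlowEnclosureWhitneyCalc — WHITNEY'S LEMMA ON EVEN FUNCTIONS, PURE SERVICE (I): the averaging integrals
# `g ↦ ∫₀¹ uᵐ F(u g) du` on a closed interval `[0, γ]`, their derivatives WITHIN the interval (both endpoints included), derivative
# towers, the Hadamard quotient, and the assembly of a `C^∞`-within-`[a, b]` function from a tower
# (β-flow team, prover 2 = lower ∕ positivity side, unit `b2b-balaban-beta-bflow-p2`, gen 26; the calculus behind P2 #43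
# `EriceFlowEnclosureWhitney`: ROAD (S) = ROAD (G) + PARITY; part (II) is `EriceFlowEnclosureWhitneyTower`)

HONEST FRAMING (page 1 of everything the β sub-cell writes): discharging `BetaPertH` makes Bałaban's UV stability UNCONDITIONAL — a
real constructive-QFT result; it is NOT the continuum limit and NOT the Clay problem.  HONEST DEPENDENCY (cell reorg 2026-08-19,
verbatim): «continuum YM on T⁴ ⇐ BetaPertH ∧ nine spine estimates (0/9 proved); BetaPertH ⇐ (D1) ∧ (D4) ∧ CAP+tail; G-an2-4 gates
asym, D1 and NE2/3/4.»  THIS MODULE DISCHARGES NOTHING of that: it is [folklore] one-variable real analysis on a closed interval with NO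
Erice letter in it — the fundamental theorem of calculus (both parts, Mathlib's `intervalIntegral`), the substitution `v = u·g`,
integration by parts for `v^{m+1}·F`, and Mathlib's `contDiffOn_succ_iff_derivWithin`.

THE POINT (H. Whitney, «Differentiable even functions», Duke Math. J. 10 (1943) 159–160 — the classical statement; the lineage needs it
with explicit constants and WITHIN a closed interval).  On the literal road (G) of P2 #42 ([Balaban1987RG1] p. 264 read in [I]'s own
variable g on `[0, γ]`) a step function `g ↦ β_n(g²)` is `C^∞` on `[0, γ]` with one bound per order; on the smooth road (S) of P2 #41
(`s = g²`) `β_n` itself is `C^∞` on `[0, γ²]`.  Road (S) ⊆ road (G) is the chain rule (P2 #42-A `gPair_of_sqPair`); the converse fails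
(P2 #42c: `−1 − g⁵`).  WHAT EXACTLY IS MISSING is parity, and the mechanism that turns parity into smoothness in `s = g²` lives on the
closed interval: with `F′(0) = 0`, `F′(g)∕g = ∫₀¹ F″(u g) du` (Hadamard), and `d∕dg ∫₀¹ uᵐ F(u g) du = ∫₀¹ u^{m+1} F′(u g) du` AT EVERY
POINT OF `[0, γ]` INCLUDING BOTH ENDPOINTS (§1: at `g > 0` by the substitution `v = u g`, FTC-1 within `[0, γ]` — the `FTCFilter` of the
closed interval — the quotient rule and integration by parts; at `g = 0` by the little-o estimate `F(v) − F(0) − vF′(0) = o(v)` within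
`[0, γ]` integrated against `uᵐ`).  So a derivative tower `(ψ_j)` within `[0, γ]` (`ψ_{j+1}` the derivative of `ψ_j` within the closed
interval) is carried to the tower `(∫₀¹ u^j ψ_{j+2}(u g) du)_j`, whose level 0 is the Hadamard quotient `ψ₁(g)∕g` when `ψ₁(0) = 0` (§2);
and a tower within `[a, b]` is a `C^∞` function with the tower as its iterated derivatives within `[a, b]` (§3).  Part (II)
(`EriceFlowEnclosureWhitneyTower`) iterates the step and composes with `√`.  STATUS: [folklore]; 0 def, 0 sorry; no Erice ∕ [I]
sentence is used or asserted here.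

WHAT THIS FILE PROVES:
§1 `avg_integrand_continuousOn`, `avg_intervalIntegrable`, `avg_zero` (value at g = 0: `F(0)∕(m+1)`), `avg_eq_inv_pow_mul_integral`
   (`= g^{−(m+1)} ∫₀ᵍ vᵐ F`), `abs_avg_le` (`≤ B∕(m+1)`), `integral_pow_succ_mul_deriv` (by parts), **`hasDerivWithinAt_avg`** (the
   derivative of the averaging integral WITHIN `[0, γ]` at every point of the closed interval is the next averaging integral of `F′`).
§2 `tower_continuousOn`, `tower_ftc`, **`tower_step`** (averaging a tower gives a tower), **`hadamard`** (`ψ₁(g) = g·∫₀¹ ψ₂(u g) du` when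
   `ψ₁(0) = 0`), `sub_eq_sq_mul_avg` (`ψ₀(g) − ψ₀(0) = g²·∫₀¹ u·(∫₀¹ ψ₂(u′u g) du′) du`).
§3 **`contDiffOn_of_tower`** (a derivative tower within `[a, b]` makes its level 0 `C^m` for every m, `∂^k` within `[a, b]` = level k).
-/

namespace Summit.QuantumFields.BalabanUV.Beta.EriceFlowEnclosureWhitneyCalc

open Filter Set Metric MeasureTheory
open scoped Topology

noncomputable section

/-! ## §1 Averaging integrals `g ↦ ∫₀¹ uᵐ F(u g) du` on `[0, γ]` -/

/-- The averaging integrand `u ↦ uᵐ F(u g)` is continuous on `[0, 1]` when `F` is continuous on `[0, γ]` and `g ∈ [0, γ]`. [folklore] -/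
theorem avg_integrand_continuousOn {F : ℝ → ℝ} {γ g : ℝ} (hF : ContinuousOn F (Icc 0 γ)) (hg : g ∈ Icc (0 : ℝ) γ) (m : ℕ) :
    ContinuousOn (fun u : ℝ => u ^ m * F (u * g)) (Icc 0 1) := by
  refine (continuousOn_id.pow m).mul (hF.comp (continuousOn_id.mul continuousOn_const) fun u hu => ?_)
  exact ⟨mul_nonneg hu.1 hg.1, (mul_le_of_le_one_left hg.1 hu.2).trans hg.2⟩

/-- … hence interval-integrable on `0..1`. [folklore] -/
theorem avg_intervalIntegrable {F : ℝ → ℝ} {γ g : ℝ} (hF : ContinuousOn F (Icc 0 γ)) (hg : g ∈ Icc (0 : ℝ) γ) (m : ℕ) :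
    IntervalIntegrable (fun u : ℝ => u ^ m * F (u * g)) volume 0 1 :=
  (avg_integrand_continuousOn hF hg m).intervalIntegrable_of_Icc zero_le_one

/-- **Value at `g = 0`**: `∫₀¹ uᵐ F(u·0) du = F(0)∕(m+1)`. [folklore] -/
theorem avg_zero (F : ℝ → ℝ) (m : ℕ) : (∫ u in (0 : ℝ)..1, u ^ m * F (u * 0)) = F 0 / (m + 1) := by
  simp only [mul_zero]
  rw [intervalIntegral.integral_mul_const, integral_pow, one_pow, zero_pow (Nat.succ_ne_zero m), sub_zero]
  ring

/-- **The substitution `v = u·g`**: for `g ≠ 0`, `∫₀¹ uᵐ F(u g) du = g^{−(m+1)}·∫₀ᵍ vᵐ F(v) dv`. [folklore] -/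
theorem avg_eq_inv_pow_mul_integral (F : ℝ → ℝ) {g : ℝ} (hg : g ≠ 0) (m : ℕ) :
    (∫ u in (0 : ℝ)..1, u ^ m * F (u * g)) = (g ^ (m + 1))⁻¹ * ∫ v in (0 : ℝ)..g, v ^ m * F v := by
  have h := intervalIntegral.integral_comp_mul_right (fun v => (v / g) ^ m * F v) hg (a := 0) (b := 1)
  simp only [zero_mul, one_mul, smul_eq_mul, mul_div_cancel_right₀ _ hg] at h
  rw [h]
  have e2 : (∫ v in (0 : ℝ)..g, (v / g) ^ m * F v) = (g ^ m)⁻¹ * ∫ v in (0 : ℝ)..g, v ^ m * F v := by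
    rw [← intervalIntegral.integral_const_mul]
    refine intervalIntegral.integral_congr fun v _ => ?_
    simp only [div_pow]
    field_simp
  rw [e2, ← mul_assoc, ← mul_inv, ← pow_succ']

/-- **The bound**: `|F| ≤ B` on `[0, γ]` and `g ∈ [0, γ]` give `|∫₀¹ uᵐ F(u g) du| ≤ B∕(m+1)` (no continuity needed: against the
integrable majorant `B·uᵐ`). [folklore] -/
theorem abs_avg_le {F : ℝ → ℝ} {γ g B : ℝ} (hg : g ∈ Icc (0 : ℝ) γ)
    (hB : ∀ v ∈ Icc (0 : ℝ) γ, |F v| ≤ B) (m : ℕ) :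
    |∫ u in (0 : ℝ)..1, u ^ m * F (u * g)| ≤ B / (m + 1) := by
  have hpt : ∀ u ∈ Ioc (0 : ℝ) 1, ‖u ^ m * F (u * g)‖ ≤ B * u ^ m := by
    intro u hu
    rw [Real.norm_eq_abs, abs_mul, abs_of_nonneg (pow_nonneg hu.1.le m), mul_comm]
    exact mul_le_mul_of_nonneg_right
      (hB _ ⟨mul_nonneg hu.1.le hg.1, (mul_le_of_le_one_left hg.1 hu.2).trans hg.2⟩) (pow_nonneg hu.1.le m)
  have h := intervalIntegral.norm_integral_le_of_norm_le (μ := volume) (f := fun u : ℝ => u ^ m * F (u * g))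
    (g := fun u : ℝ => B * u ^ m) zero_le_one (Eventually.of_forall hpt)
    ((continuousOn_const.mul (continuousOn_id.pow m)).intervalIntegrable_of_Icc zero_le_one)
  rw [Real.norm_eq_abs] at h
  refine h.trans_eq ?_
  rw [intervalIntegral.integral_const_mul, integral_pow, one_pow, zero_pow (Nat.succ_ne_zero m), sub_zero]
  ring

/-- **Integration by parts for `v^{m+1}·F` on `[0, g] ⊆ [0, γ]`**: if `F` has derivative `F′` within `[0, γ]` at every point of
`[0, γ]` and `F′` is continuous on `[0, γ]`, then `∫₀ᵍ v^{m+1} F′(v) dv = g^{m+1} F(g) − (m+1)·∫₀ᵍ vᵐ F(v) dv`. [folklore] -/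
theorem integral_pow_succ_mul_deriv {F F' : ℝ → ℝ} {γ g : ℝ} (hg : g ∈ Icc (0 : ℝ) γ)
    (hF : ∀ v ∈ Icc (0 : ℝ) γ, HasDerivWithinAt F (F' v) (Icc 0 γ) v) (hF' : ContinuousOn F' (Icc 0 γ)) (m : ℕ) :
    (∫ v in (0 : ℝ)..g, v ^ (m + 1) * F' v)
      = g ^ (m + 1) * F g - (m + 1) * ∫ v in (0 : ℝ)..g, v ^ m * F v := by
  have hFc : ContinuousOn F (Icc 0 γ) := fun v hv => (hF v hv).continuousWithinAt
  have hsub : Icc 0 g ⊆ Icc 0 γ := Icc_subset_Icc le_rfl hg.2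
  have hi1 : IntervalIntegrable (fun v : ℝ => ((m : ℝ) + 1) * (v ^ m * F v)) volume 0 g :=
    ((continuousOn_const.mul ((continuousOn_id.pow m).mul (hFc.mono hsub))).intervalIntegrable_of_Icc hg.1)
  have hi2 : IntervalIntegrable (fun v : ℝ => v ^ (m + 1) * F' v) volume 0 g :=
    (((continuousOn_id.pow _).mul (hF'.mono hsub)).intervalIntegrable_of_Icc hg.1)
  have key := intervalIntegral.integral_eq_sub_of_hasDeriv_right_of_le hg.1
    (f := fun v => v ^ (m + 1) * F v) (f' := fun v => ((m : ℝ) + 1) * (v ^ m * F v) + v ^ (m + 1) * F' v)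
    ((continuousOn_id.pow _).mul (hFc.mono hsub))
    (fun v hv => by
      have hvI : v ∈ Icc (0 : ℝ) γ := hsub (Ioo_subset_Icc_self hv)
      have hd : HasDerivAt F (F' v) v := (hF v hvI).hasDerivAt (Icc_mem_nhds hv.1 (hv.2.trans_le hg.2))
      have hp : HasDerivAt (fun x : ℝ => x ^ (m + 1)) (((m : ℝ) + 1) * v ^ m) v := by
        simpa using hasDerivAt_pow (m + 1) v
      exact ((hp.mul hd).hasDerivWithinAt).congr_deriv (by ring))
    (hi1.add hi2)
  rw [intervalIntegral.integral_add hi1 hi2, intervalIntegral.integral_const_mul] at key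
  have e0 : (0 : ℝ) ^ (m + 1) * F 0 = 0 := by simp
  rw [e0, sub_zero] at key
  linarith

/-- **THE DERIVATIVE OF THE AVERAGING INTEGRAL WITHIN THE CLOSED INTERVAL.**  If `F` has derivative `F′` within `[0, γ]` (`0 < γ`) at
every point of `[0, γ]` and `F′` is continuous on `[0, γ]`, then at EVERY `g ∈ [0, γ]` — both endpoints included —
`g ↦ ∫₀¹ uᵐ F(u g) du` has derivative `∫₀¹ u^{m+1} F′(u g) du` within `[0, γ]`.  At `g > 0`: the substitution form `g^{−(m+1)} ∫₀ᵍ vᵐ F`,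
FTC-1 within `[0, γ]` (`intervalIntegral.integral_hasDerivWithinAt_right`, the `FTCFilter` of the closed interval), the quotient rule and
§1's integration by parts; at `g = 0`: `F(v) − F(0) − v F′(0) = o(v)` within `[0, γ]` integrated against `uᵐ`. [folklore] -/
theorem hasDerivWithinAt_avg {F F' : ℝ → ℝ} {γ : ℝ} (hγ : 0 < γ)
    (hF : ∀ v ∈ Icc (0 : ℝ) γ, HasDerivWithinAt F (F' v) (Icc 0 γ) v) (hF' : ContinuousOn F' (Icc 0 γ)) (m : ℕ) :
    ∀ g ∈ Icc (0 : ℝ) γ, HasDerivWithinAt (fun g => ∫ u in (0 : ℝ)..1, u ^ m * F (u * g))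
      (∫ u in (0 : ℝ)..1, u ^ (m + 1) * F' (u * g)) (Icc 0 γ) g := by
  have hFc : ContinuousOn F (Icc 0 γ) := fun v hv => (hF v hv).continuousWithinAt
  intro g hg
  rcases eq_or_lt_of_le hg.1 with h0 | hpos
  · -- at g = 0
    subst h0
    rw [hasDerivWithinAt_iff_isLittleO, Asymptotics.isLittleO_iff]
    intro ε hε
    have h0d := hF 0 ⟨le_rfl, hγ.le⟩
    rw [hasDerivWithinAt_iff_isLittleO, Asymptotics.isLittleO_iff] at h0d
    have h0d' := h0d hε
    rw [eventually_nhdsWithin_iff, Metric.eventually_nhds_iff] at h0d' ⊢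
    obtain ⟨δ, hδ, hδb⟩ := h0d'
    refine ⟨δ, hδ, fun x hxδ hx => ?_⟩
    have hxI : x ∈ Icc (0 : ℝ) γ := hx
    have hI1 := avg_intervalIntegrable hFc hxI m
    have hI0 : IntervalIntegrable (fun u : ℝ => u ^ m * F (u * 0)) volume 0 1 := avg_intervalIntegrable hFc ⟨le_rfl, hγ.le⟩ m
    have hI2 : IntervalIntegrable (fun u : ℝ => (x - 0) * (u ^ (m + 1) * F' (u * 0))) volume 0 1 :=
      (avg_intervalIntegrable hF' ⟨le_rfl, hγ.le⟩ (m + 1)).const_mul _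
    have e : (∫ u in (0 : ℝ)..1, u ^ m * F (u * x)) - (∫ u in (0 : ℝ)..1, u ^ m * F (u * 0))
        - (x - 0) • (∫ u in (0 : ℝ)..1, u ^ (m + 1) * F' (u * 0))
        = ∫ u in (0 : ℝ)..1, u ^ m * (F (u * x) - F 0 - (u * x - 0) * F' 0) := by
      rw [smul_eq_mul, ← intervalIntegral.integral_const_mul, ← intervalIntegral.integral_sub hI1 hI0,
        ← intervalIntegral.integral_sub (hI1.sub hI0) hI2]
      refine intervalIntegral.integral_congr fun u _ => ?_
      simp only [mul_zero]
      ring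
    rw [e]
    have hxδ' : x < δ := by
      rw [dist_zero_right, Real.norm_eq_abs, abs_of_nonneg hxI.1] at hxδ
      exact hxδ
    have hpt : ∀ u ∈ Ioc (0 : ℝ) 1, ‖u ^ m * (F (u * x) - F 0 - (u * x - 0) * F' 0)‖ ≤ ε * x * u ^ (m + 1) := by
      intro u hu
      have huxI : u * x ∈ Icc (0 : ℝ) γ := ⟨mul_nonneg hu.1.le hxI.1, (mul_le_of_le_one_left hxI.1 hu.2).trans hxI.2⟩
      have hux : dist (u * x) 0 < δ := by
        rw [dist_zero_right, Real.norm_eq_abs, abs_of_nonneg huxI.1]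
        exact (mul_le_of_le_one_left hxI.1 hu.2).trans_lt hxδ'
      have hb := hδb hux huxI
      rw [smul_eq_mul, Real.norm_eq_abs, Real.norm_eq_abs, sub_zero, abs_of_nonneg huxI.1] at hb
      rw [Real.norm_eq_abs, abs_mul, abs_of_nonneg (pow_nonneg hu.1.le m), sub_zero, pow_succ]
      calc u ^ m * |F (u * x) - F 0 - u * x * F' 0| ≤ u ^ m * (ε * (u * x)) :=
            mul_le_mul_of_nonneg_left hb (pow_nonneg hu.1.le m)
        _ = ε * x * (u ^ m * u) := by ring
    have h := intervalIntegral.norm_integral_le_of_norm_le (μ := volume)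
      (f := fun u : ℝ => u ^ m * (F (u * x) - F 0 - (u * x - 0) * F' 0))
      (g := fun u : ℝ => ε * x * u ^ (m + 1)) zero_le_one (Eventually.of_forall hpt)
      ((continuousOn_const.mul (continuousOn_id.pow (m + 1))).intervalIntegrable_of_Icc zero_le_one)
    refine h.trans ?_
    rw [intervalIntegral.integral_const_mul, integral_pow, Real.norm_eq_abs, sub_zero, abs_of_nonneg hxI.1, one_pow,
      zero_pow (Nat.succ_ne_zero _), sub_zero]
    have hm : (1 : ℝ) ≤ (m + 1 : ℕ) + 1 := by
      have : (0 : ℝ) ≤ (m + 1 : ℕ) := by positivity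
      linarith
    have hεx : 0 ≤ ε * x := mul_nonneg hε.le hxI.1
    calc ε * x * (1 / ((m + 1 : ℕ) + 1 : ℝ)) ≤ ε * x * 1 :=
          mul_le_mul_of_nonneg_left (by rw [div_le_one (by positivity)]; exact hm) hεx
      _ = ε * x := mul_one _
  · -- at 0 < g ≤ γ
    have hco : ContinuousOn (fun v : ℝ => v ^ m * F v) (Icc 0 γ) := (continuousOn_id.pow m).mul hFc
    have hΦ : HasDerivWithinAt (fun x => ∫ v in (0 : ℝ)..x, v ^ m * F v) (g ^ m * F g) (Icc 0 γ) g := by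
      haveI : Fact (g ∈ Icc (0 : ℝ) γ) := ⟨hg⟩
      exact intervalIntegral.integral_hasDerivWithinAt_right
        ((hco.mono (Icc_subset_Icc le_rfl hg.2)).intervalIntegrable_of_Icc hg.1)
        (hco.stronglyMeasurableAtFilter_nhdsWithin measurableSet_Icc g) (hco g hg)
    have hpow : HasDerivWithinAt (fun x : ℝ => x ^ (m + 1)) (((m : ℝ) + 1) * g ^ m) (Icc 0 γ) g := by
      simpa using (hasDerivAt_pow (m + 1) g).hasDerivWithinAt
    have hinv := hpow.inv (pow_ne_zero _ hpos.ne')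
    have hprod := hinv.mul hΦ
    have hbp := integral_pow_succ_mul_deriv hg hF hF' m
    have hev : ∀ᶠ x in 𝓝[Icc (0 : ℝ) γ] g, 0 < x := eventually_nhdsWithin_of_eventually_nhds (lt_mem_nhds hpos)
    refine (hprod.congr_of_eventuallyEq ?_ ?_).congr_deriv ?_
    · filter_upwards [hev] with x hx
      exact avg_eq_inv_pow_mul_integral F hx.ne' m
    · exact avg_eq_inv_pow_mul_integral F hpos.ne' m
    · rw [avg_eq_inv_pow_mul_integral F' hpos.ne' (m + 1), hbp]
      simp only [Pi.inv_apply]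
      field_simp
      ring

/-! ## §2 Derivative towers within `[0, γ]`: averaging a tower, the Hadamard quotient -/

/-- Every level of a derivative tower within `[0, γ]` is continuous on `[0, γ]`. [folklore] -/
theorem tower_continuousOn {ψ : ℕ → ℝ → ℝ} {γ : ℝ}
    (hψ : ∀ j, ∀ x ∈ Icc (0 : ℝ) γ, HasDerivWithinAt (ψ j) (ψ (j + 1) x) (Icc 0 γ) x) (j : ℕ) :
    ContinuousOn (ψ j) (Icc 0 γ) := fun x hx => (hψ j x hx).continuousWithinAt

/-- FTC-2 along a tower: `ψ j g − ψ j 0 = ∫₀ᵍ ψ (j+1)` for `g ∈ [0, γ]`. [folklore] -/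
theorem tower_ftc {ψ : ℕ → ℝ → ℝ} {γ : ℝ}
    (hψ : ∀ j, ∀ x ∈ Icc (0 : ℝ) γ, HasDerivWithinAt (ψ j) (ψ (j + 1) x) (Icc 0 γ) x) (j : ℕ) :
    ∀ g ∈ Icc (0 : ℝ) γ, ψ j g - ψ j 0 = ∫ v in (0 : ℝ)..g, ψ (j + 1) v := by
  intro g hg
  have hsub : Icc 0 g ⊆ Icc 0 γ := Icc_subset_Icc le_rfl hg.2
  rw [intervalIntegral.integral_eq_sub_of_hasDeriv_right_of_le hg.1 ((tower_continuousOn hψ j).mono hsub)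
    (fun v hv => ((hψ j v (hsub (Ioo_subset_Icc_self hv))).hasDerivAt
      (Icc_mem_nhds hv.1 (hv.2.trans_le hg.2))).hasDerivWithinAt)
    (((tower_continuousOn hψ (j + 1)).mono hsub).intervalIntegrable_of_Icc hg.1)]

/-- **AVERAGING A TOWER GIVES A TOWER**: if `(ψ_j)` is a derivative tower within `[0, γ]` (`0 < γ`), so is
`(g ↦ ∫₀¹ u^j ψ_{j+2}(u g) du)_j` (§1 `hasDerivWithinAt_avg` at every level). [folklore] -/
theorem tower_step {ψ : ℕ → ℝ → ℝ} {γ : ℝ} (hγ : 0 < γ)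
    (hψ : ∀ j, ∀ x ∈ Icc (0 : ℝ) γ, HasDerivWithinAt (ψ j) (ψ (j + 1) x) (Icc 0 γ) x) :
    ∀ j, ∀ x ∈ Icc (0 : ℝ) γ, HasDerivWithinAt (fun g => ∫ u in (0 : ℝ)..1, u ^ j * ψ (j + 2) (u * g))
      (∫ u in (0 : ℝ)..1, u ^ (j + 1) * ψ (j + 1 + 2) (u * x)) (Icc 0 γ) x := by
  intro j x hx
  exact hasDerivWithinAt_avg hγ (hψ (j + 2)) (tower_continuousOn hψ (j + 2 + 1)) j x hx

/-- **THE HADAMARD QUOTIENT**: along a tower with `ψ 1 0 = 0`, `ψ 1 g = g·∫₀¹ ψ 2 (u g) du` on `[0, γ]` (FTC-2 and the substitution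
`v = u g`). [folklore] -/
theorem hadamard {ψ : ℕ → ℝ → ℝ} {γ : ℝ}
    (hψ : ∀ j, ∀ x ∈ Icc (0 : ℝ) γ, HasDerivWithinAt (ψ j) (ψ (j + 1) x) (Icc 0 γ) x) (h10 : ψ 1 0 = 0) :
    ∀ g ∈ Icc (0 : ℝ) γ, ψ 1 g = g * ∫ u in (0 : ℝ)..1, u ^ 0 * ψ 2 (u * g) := by
  intro g hg
  rcases eq_or_lt_of_le hg.1 with h0 | hpos
  · rw [← h0, h10, zero_mul]
  · have h := tower_ftc hψ 1 g hg
    rw [h10, sub_zero] at h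
    rw [avg_eq_inv_pow_mul_integral _ hpos.ne' 0, h]
    simp only [pow_zero, one_mul, zero_add, pow_one]
    rw [mul_inv_cancel_left₀ hpos.ne']

/-- **THE SECOND-ORDER HADAMARD STEP AT THE ORIGIN**: along a tower with `ψ 1 0 = 0`, for `g ∈ [0, γ]`,
`ψ 0 g − ψ 0 0 = g²·∫₀¹ u·(∫₀¹ ψ 2 (u′·(u g)) du′) du` (FTC-2, `hadamard` under the integral, the substitution with `m = 1`).
[folklore] -/
theorem sub_eq_sq_mul_avg {ψ : ℕ → ℝ → ℝ} {γ : ℝ}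
    (hψ : ∀ j, ∀ x ∈ Icc (0 : ℝ) γ, HasDerivWithinAt (ψ j) (ψ (j + 1) x) (Icc 0 γ) x) (h10 : ψ 1 0 = 0) :
    ∀ g ∈ Icc (0 : ℝ) γ, ψ 0 g - ψ 0 0
      = g ^ 2 * ∫ u in (0 : ℝ)..1, u ^ 1 * ∫ u' in (0 : ℝ)..1, u' ^ 0 * ψ 2 (u' * (u * g)) := by
  intro g hg
  rcases eq_or_lt_of_le hg.1 with h0 | hpos
  · rw [← h0]; simp
  · rw [tower_ftc hψ 0 g hg,
      avg_eq_inv_pow_mul_integral (fun y => ∫ u' in (0 : ℝ)..1, u' ^ 0 * ψ 2 (u' * y)) hpos.ne' 1, ← mul_assoc,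
      mul_inv_cancel₀ (pow_ne_zero _ hpos.ne'), one_mul]
    refine intervalIntegral.integral_congr fun v hv => ?_
    rw [uIcc_of_le hg.1] at hv
    simp only [zero_add, pow_one]
    exact hadamard hψ h10 v ⟨hv.1, hv.2.trans hg.2⟩

/-! ## §3 Assembly: a derivative tower within `[a, b]` is a `C^∞` function with the tower as its iterated derivatives -/

/-- **A TOWER IS A `C^∞` FUNCTION.**  If `H (k+1)` is the derivative of `H k` within `[a, b]` (`a < b`) at every point of `[a, b]`, for
every k, then `H 0` is `C^m` on `[a, b]` for every m and `iteratedDerivWithin k (H 0) (Icc a b) = H k` on `[a, b]` (induction on the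
order with Mathlib's `contDiffOn_succ_iff_derivWithin` and `iteratedDerivWithin_succ'`; unique differentiability of the closed
interval). [folklore] -/
theorem contDiffOn_of_tower {H : ℕ → ℝ → ℝ} {a b : ℝ} (hab : a < b)
    (hH : ∀ k, ∀ x ∈ Icc a b, HasDerivWithinAt (H k) (H (k + 1) x) (Icc a b) x) :
    (∀ m : ℕ, ContDiffOn ℝ m (H 0) (Icc a b)) ∧
      ∀ k, ∀ x ∈ Icc a b, iteratedDerivWithin k (H 0) (Icc a b) x = H k x := by
  have P : ∀ m : ℕ, ∀ G : ℕ → ℝ → ℝ, (∀ k, ∀ x ∈ Icc a b, HasDerivWithinAt (G k) (G (k + 1) x) (Icc a b) x) →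
      ContDiffOn ℝ m (G 0) (Icc a b) ∧ ∀ x ∈ Icc a b, iteratedDerivWithin m (G 0) (Icc a b) x = G m x := by
    intro m
    induction m with
    | zero =>
      intro G hG
      exact ⟨contDiffOn_zero.mpr fun x hx => (hG 0 x hx).continuousWithinAt, fun x _ => by simp⟩
    | succ m ih =>
      intro G hG
      have hderiv : EqOn (derivWithin (G 0) (Icc a b)) (G 1) (Icc a b) :=
        fun x hx => (hG 0 x hx).derivWithin (uniqueDiffOn_Icc hab x hx)
      have ih' := ih (fun k => G (k + 1)) (fun k => hG (k + 1))
      refine ⟨?_, fun x hx => ?_⟩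
      · have e : ((m + 1 : ℕ) : WithTop ℕ∞) = (m : WithTop ℕ∞) + 1 := by norm_cast
        rw [e, contDiffOn_succ_iff_derivWithin (uniqueDiffOn_Icc hab)]
        refine ⟨fun x hx => (hG 0 x hx).differentiableWithinAt, fun h => ?_, ih'.1.congr hderiv⟩
        exact absurd h (by simp)
      · rw [iteratedDerivWithin_succ', iteratedDerivWithin_congr hderiv hx]
        exact ih'.2 x hx
  exact ⟨fun m => (P m H hH).1, fun k => (P k H hH).2⟩

end

end Summit.QuantumFields.BalabanUV.Beta.EriceFlowEnclosureWhitneyCalc
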